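import Literature.NumberTheory.Transcendental.ManyCurveTheta
import Literature.NumberTheory.Transcendental.NonVanishing
import Literature.NumberTheory.Transcendental.LineODEModel
import HarnessLib

/-!
# Chart generators, line jets and word forms on the `k`-lattice standard models

Topic `Literature/NumberTheory/Transcendental`; unit
`provefact-Literature.NumberTheory.Transcendental.H-0a3eb64689` (fact
`Literature.NumberTheory.Transcendental.HuberWustholzManyCurvePeriods`, `ManyCurvePeriods.lean`).
It introduces NO named fact. Lattice-family counterpart of the two-lattice `TwoCurveLineODE.lean`
(port of the one-lattice files `LineODEGens.lean`, `LineJetsBasic.lean`, `LineODETheta.lean`,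
`LineJetForms.lean`, `LineODEAlg.lean`, `NonVanishing.lean` and `LineODEModel.lean`), for the
family standard models `M = 𝔾ₘ^β × P` of `ManyCurveStd.lean` / `ManyCurveTheta.lean` (lattice
family `L : 𝓙 → PeriodPair`, class map `cls : γ → 𝓙`). All per-factor objects of the one-lattice
files (`factorGen`, `zetaHat`, `factorODE`, `rPoly`, `corrPoly`, `rVal`, `corrVal`,
`factor_blocks`, the generic-coefficient models `factorODEᵣ`, …) are REUSED with the lattice
`Λ_{cls b}` of the block; only the objects summing over all blocks are re-proved here, verbatim.

## What is proved here (everything; no `sorry`, no new `def … : Prop`)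

* `genFun`, `genODE`, `chartDomain`, `chartChoiceAt`, `hasDerivAt_genFun` (the generators along a
  line solve their polynomial system), `iteratedDeriv_eval_genFun`;
* `chartCoord`, `thetaEval_eq_pow_mul_eval_chart` (dehomogenisation),
  `vanishesAlong_thetaEval_iff_chart`; `HPoly`, `chartCoord_baseIdx_eq_eval` (chart coordinates are
  polynomials in the generators), the jet formula `vanishesAlong_thetaEval_iff_der`;
* `wordForm` and `vanishesAlong_span_of_wordForms` (finitely many linear conditions force
  vanishing along the span);
* `chartCoord_mem_Kbar`, `genFun_zero_eq_chartCoord`, `isAlgebraic_genFun_zero` (generator values at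
  algebraic points are algebraic, each block with the invariants of its own lattice);
* `thetaEval_homog`, `exists_thetaEval_homog_ne_zero` (forms built from non-zero affine
  polynomials do not vanish identically on `M`);
* `genODEᵣ`, `HPolyᵣ` (generic-coefficient models with classwise invariants
  `g₂ i, g₃ i`, `i : 𝓙`), `genODEᵣ_complex`, `HPolyᵣ_complex`, `map_genODEᵣ`, `map_HPolyᵣ`,
  `wordForm_eq_map` (word forms computed over a field of definition).

## References

* A. Baker, G. Wüstholz, *Logarithmic Forms and Diophantine Geometry*, CUP 2007, §6.7–6.8.
  [BakerWustholz2007]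
* A. Baker, *Transcendental Number Theory*, CUP 1975, Ch. 2 §3. [BakerTNT1975]
* A. Huber, G. Wüstholz, *Transcendence and Linear Relations of 1-Periods*, Cambridge Tracts 227,
  CUP 2022, Thm. 15.3 (1). [HuberWustholz2022]
-/

noncomputable section

open Complex Filter Topology MvPolynomial
open scoped PeriodPair

namespace Literature.NumberTheory.Transcendental

namespace GaGmEFam

namespace Std

open GaGmE (Kbar)
open GaGmE.Std (iy iz is coords coords_iy coords_iz coords_is sum_blocks ThetaIdx thetaT thetaT_none
  thetaT_some differentiable_thetaT VanishesAlong isAlgebraic_coe_Kbar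
  Gen factorGen zetaHat zetaHatDer factorODE zetaHatODE FactorChartValid isOpen_factorChartValid
  factorGen_false factorGen_true zetaHat_false zetaHat_true hasDerivAt_zetaHat
  baseFin baseIdx rPoly corrPoly TPoly rVal corrVal factor_blocks line_apply genFin genIdx
  rVal_baseFin corrVal_baseFin rVal_genFin genericChart affGen affIdx homog isHomogeneous_homog
  eval_homog_of_base_eq_one)

variable {𝓙 : Type} [DecidableEq 𝓙] {β γ δ : Type} [Fintype β] [Fintype γ] [Fintype δ] [DecidableEq γ]
variable (L : 𝓙 → PeriodPair) (cls : γ → 𝓙) (κM : δ → γ → Kbar)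

/-! ### Chart generators along a line and their differential system -/

/-- **The generators along the line `ξ ↦ w + ξx`** for the chart choice `c`: torus exponentials,
factor generators, and the regularised fibre coordinates `Ñ_e = s'_e - ∑_b κ_{eb} ζ̂_b(z'_b)`.
[folklore] -/
def genFun (c : γ → Bool) (w x : β ⊕ (γ ⊕ δ) → ℂ) (ξ : ℂ) : Gen β γ δ → ℂ
  | Sum.inl j => cexp (w (iy j) + ξ * x (iy j))
  | Sum.inr (Sum.inl (b, i)) => factorGen (L (cls b)) (c b) i (w (iz b) + ξ * x (iz b))
  | Sum.inr (Sum.inr e) => w (is e) + ξ * x (is e) -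
      ∑ b, (κM e b : ℂ) * zetaHat (L (cls b)) (c b) (w (iz b) + ξ * x (iz b))


/-- **The differential system of the generators** along the direction `x`:
`E_j′ = x_jE_j`, factor equations times `x_b`, `Ñ_e′ = x_e - ∑_b κ_{eb} x_b ζ̂_b′`. [folklore] -/
def genODE (c : γ → Bool) (x : β ⊕ (γ ⊕ δ) → ℂ) : Gen β γ δ → MvPolynomial (Gen β γ δ) ℂ
  | Sum.inl j => C (x (iy j)) * X (Sum.inl j)
  | Sum.inr (Sum.inl (b, i)) => C (x (iz b)) * factorODE (L (cls b)) (c b) b i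
  | Sum.inr (Sum.inr e) => C (x (is e)) - ∑ b, C ((κM e b : ℂ) * x (iz b)) * zetaHatODE (L (cls b)) (c b) b


/-- The set of parameters `ξ` at which all chosen charts are valid along `ξ ↦ w + ξx`.
[folklore] -/
def chartDomain (c : γ → Bool) (w x : β ⊕ (γ ⊕ δ) → ℂ) : Set ℂ :=
  {ξ | ∀ b, FactorChartValid (L (cls b)) (c b) (w (iz b) + ξ * x (iz b))}


omit [Fintype β] [Fintype δ] [DecidableEq γ] in
omit [DecidableEq 𝓙] in
/-- **The chart domain is open.** [folklore] -/
theorem isOpen_chartDomain (c : γ → Bool) (w x : β ⊕ (γ ⊕ δ) → ℂ) :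
    IsOpen (chartDomain L cls c w x) := by
  have : chartDomain L cls c w x = ⋂ b, (fun ξ : ℂ => w (iz b) + ξ * x (iz b)) ⁻¹'
      {z : ℂ | FactorChartValid (L (cls b)) (c b) z} := by
    ext ξ; simp [chartDomain, Set.mem_iInter]
  rw [this]
  exact isOpen_iInter_of_finite fun b =>
    (isOpen_factorChartValid (L (cls b)) (c b)).preimage (by fun_prop)


/-- The chart choice adapted to the point `w`: origin chart exactly at the factors with
`w_b ∈ Λ`. [folklore] -/
def chartChoiceAt (w : β ⊕ (γ ⊕ δ) → ℂ) : γ → Bool := fun b =>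
  open Classical in if w (iz b) ∈ (L (cls b)).lattice then true else false


omit [Fintype β] [Fintype γ] [Fintype δ] [DecidableEq γ] in
omit [DecidableEq 𝓙] in
/-- The adapted chart choice is valid at `ξ = 0`. [folklore] -/
theorem zero_mem_chartDomain_chartChoiceAt (w x : β ⊕ (γ ⊕ δ) → ℂ) :
    (0 : ℂ) ∈ chartDomain L cls (chartChoiceAt L cls w) w x := by
  intro b
  simp only [zero_mul, add_zero, chartChoiceAt]
  by_cases hb : w (iz b) ∈ (L (cls b)).lattice
  · simp only [hb, if_true, FactorChartValid]
    obtain ⟨m, n, hmn⟩ := PeriodPair.mem_lattice.mp hb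
    rw [← hmn]
    exact ((L (cls b)).latU_latP_latG_lattice m n).1
  · simp [hb, FactorChartValid]


omit [Fintype β] [Fintype δ] [DecidableEq γ] in
omit [DecidableEq 𝓙] in
/-- `zetaHatODE` evaluates to `zetaHatDer` at the generators. [folklore] -/
theorem eval_zetaHatODE (c : γ → Bool) (w x : β ⊕ (γ ⊕ δ) → ℂ) (ξ : ℂ) (b : γ) :
    MvPolynomial.eval (genFun L cls κM c w x ξ) (zetaHatODE (L (cls b)) (c b) b) =
      zetaHatDer (L (cls b)) (c b) (w (iz b) + ξ * x (iz b)) := by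
  cases hc : c b <;> simp [zetaHatODE, zetaHatDer, genFun, hc]


omit [Fintype β] [Fintype δ] [DecidableEq γ] in
omit [DecidableEq 𝓙] in
/-- **The generators solve the polynomial system on the chart domain**: for `ξ` in
`chartDomain c w x` and every generator index `i`,
`(genFun c w x · i)′(ξ) = (genODE c x i)(genFun c w x ξ)`. This is the hypothesis of
`PolyODE.hasDerivAt_eval_of_ode` / `PolyODE.iteratedDeriv_eval_of_ode`.
[cite: BakerWustholz2007, §6.7 (pp. 112–113: the operators 𝒟 act on R)] -/
theorem hasDerivAt_genFun (c : γ → Bool) (w x : β ⊕ (γ ⊕ δ) → ℂ) {ξ : ℂ}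
    (hξ : ξ ∈ chartDomain L cls c w x) (i : Gen β γ δ) :
    HasDerivAt (fun ξ : ℂ => genFun L cls κM c w x ξ i)
      (MvPolynomial.eval (genFun L cls κM c w x ξ) (genODE L cls κM c x i)) ξ := by
  rcases i with j | ⟨b, i⟩ | e
  · -- torus: `E_j = exp(w_j + ξ x_j)`, `E_j′ = x_j E_j`
    have hlin : HasDerivAt (fun ξ : ℂ => w (iy j) + ξ * x (iy j)) (x (iy j)) ξ := by
      simpa using ((hasDerivAt_id ξ).mul_const (x (iy j))).const_add (w (iy j))
    have H : HasDerivAt (fun ξ : ℂ => cexp (w (iy j) + ξ * x (iy j)))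
        (x (iy j) * cexp (w (iy j) + ξ * x (iy j))) ξ := hlin.cexp.congr_deriv (by ring)
    simpa [genFun, genODE] using H
  · -- an `E`-factor, at `z' = w_b + ξ x_b`
    have hlin : HasDerivAt (fun ξ : ℂ => w (iz b) + ξ * x (iz b)) (x (iz b)) ξ := by
      simpa using ((hasDerivAt_id ξ).mul_const (x (iz b))).const_add (w (iz b))
    have hv : FactorChartValid (L (cls b)) (c b) (w (iz b) + ξ * x (iz b)) := hξ b
    cases hc : c b
    · -- generic chart `(℘, ℘′)`
      have hz : w (iz b) + ξ * x (iz b) ∉ (L (cls b)).lattice := by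
        simpa [FactorChartValid, hc] using hv
      fin_cases i
      · have H : HasDerivAt (fun ξ : ℂ => ℘[L (cls b)] (w (iz b) + ξ * x (iz b)))
            (x (iz b) * ℘'[L (cls b)] (w (iz b) + ξ * x (iz b))) ξ :=
          by
            have H0 := (PeriodPair.hasDerivAt_weierstrassP hz).comp ξ hlin
            exact H0.congr_deriv (by ring)
        simpa [genFun, genODE, factorODE, hc] using H
      · have H : HasDerivAt (fun ξ : ℂ => ℘'[L (cls b)] (w (iz b) + ξ * x (iz b)))
            (x (iz b) * (6 * ℘[L (cls b)] (w (iz b) + ξ * x (iz b)) ^ 2 - (L (cls b)).g₂ / 2)) ξ :=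
          by
            have H0 := ((L (cls b)).hasDerivAt_derivWeierstrassP hz).comp ξ hlin
            exact H0.congr_deriv (by ring)
        simpa [genFun, genODE, factorODE, hc] using H
    · -- origin chart `(u, p)`
      have h2 : (L (cls b)).univExtP 2 (w (iz b) + ξ * x (iz b)) ≠ 0 := by
        simpa [FactorChartValid, hc] using hv
      fin_cases i
      · have H : HasDerivAt (fun ξ : ℂ => (L (cls b)).latU (w (iz b) + ξ * x (iz b)))
            (x (iz b) * (-6 * (L (cls b)).latP (w (iz b) + ξ * x (iz b)) ^ 2 +
              (L (cls b)).g₂ / 2 * (L (cls b)).latU (w (iz b) + ξ * x (iz b)) ^ 2)) ξ :=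
          by
            have H0 := (PeriodPair.hasDerivAt_latU h2).comp ξ hlin
            exact H0.congr_deriv (by ring)
        simpa [genFun, genODE, factorODE, hc] using H
      · have H : HasDerivAt (fun ξ : ℂ => (L (cls b)).latP (w (iz b) + ξ * x (iz b)))
            (x (iz b) * (-1 / 2 - (L (cls b)).g₂ * (L (cls b)).latP (w (iz b) + ξ * x (iz b)) *
              (L (cls b)).latU (w (iz b) + ξ * x (iz b)) -
              3 * (L (cls b)).g₃ / 2 * (L (cls b)).latU (w (iz b) + ξ * x (iz b)) ^ 2)) ξ :=
          by
            have H0 := (PeriodPair.hasDerivAt_latP h2).comp ξ hlin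
            exact H0.congr_deriv (by ring)
        simpa [genFun, genODE, factorODE, hc] using H
  · -- fibre: `Ñ_e = s_e(w) + ξ x_e - ∑_b κ_{eb} ζ̂_b(w_b + ξ x_b)`
    have hlin : HasDerivAt (fun ξ : ℂ => w (is e) + ξ * x (is e)) (x (is e)) ξ := by
      simpa using ((hasDerivAt_id ξ).mul_const (x (is e))).const_add (w (is e))
    have hsum : HasDerivAt
        (fun ξ : ℂ => ∑ b, (κM e b : ℂ) * zetaHat (L (cls b)) (c b) (w (iz b) + ξ * x (iz b)))
        (∑ b, (κM e b : ℂ) * (x (iz b) * zetaHatDer (L (cls b)) (c b) (w (iz b) + ξ * x (iz b)))) ξ := by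
      exact HasDerivAt.fun_sum (u := Finset.univ)
        (A := fun b (ξ : ℂ) => (κM e b : ℂ) * zetaHat (L (cls b)) (c b) (w (iz b) + ξ * x (iz b)))
        (A' := fun b => (κM e b : ℂ) * (x (iz b) * zetaHatDer (L (cls b)) (c b) (w (iz b) + ξ * x (iz b))))
        (x := ξ) fun b _ => (hasDerivAt_zetaHat (c b) (hξ b)).const_mul _
    have H := hlin.sub hsum
    have hval : MvPolynomial.eval (genFun L cls κM c w x ξ) (genODE L cls κM c x (Sum.inr (Sum.inr e))) =
        x (is e) - ∑ b, (κM e b : ℂ) * (x (iz b) * zetaHatDer (L (cls b)) (c b) (w (iz b) + ξ * x (iz b))) := by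
      simp only [genODE, map_sub, map_sum, map_mul, eval_C]
      congr 1
      exact Finset.sum_congr rfl fun b _ => by rw [eval_zetaHatODE]; ring
    rw [hval]
    exact H


omit [Fintype β] [Fintype δ] [DecidableEq γ] in
omit [DecidableEq 𝓙] in
/-- **Jets of polynomials in the generators.** On the chart domain the `k`-th derivative at `ξ`
of `ξ ↦ H(genFun ξ)` is the value at `genFun ξ` of `D^k H`, `D` the derivation with
`D Xᵢ = genODE i` (`PolyODEJets.lean`). [folklore] -/
theorem iteratedDeriv_eval_genFun (c : γ → Bool) (w x : β ⊕ (γ ⊕ δ) → ℂ)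
    (H : MvPolynomial (Gen β γ δ) ℂ) (k : ℕ) {ξ : ℂ} (hξ : ξ ∈ chartDomain L cls c w x) :
    iteratedDeriv k (fun ξ : ℂ => MvPolynomial.eval (genFun L cls κM c w x ξ) H) ξ =
      MvPolynomial.eval (genFun L cls κM c w x ξ) ((PolyODE.der (genODE L cls κM c x))^[k] H) :=
  PolyODE.iteratedDeriv_eval_of_ode (genODE L cls κM c x) (g := genFun L cls κM c w x)
    (isOpen_chartDomain L cls c w x) (fun _ hζ i => hasDerivAt_genFun L cls κM c w x hζ i) k H ξ hξ


/-! ### Dehomogenisation in a chart, vanishing along a subspace in chart terms -/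

/-- The affine chart coordinates `A_J = Θ_J/Θ_{J₀}` of `M_κ` at points where `Θ_{J₀} ≠ 0`.
[folklore] -/
def chartCoord (J₀ J : Option β × ThetaIdx γ δ) (w : β ⊕ (γ ⊕ δ) → ℂ) : ℂ :=
  theta L cls κM J w / theta L cls κM J₀ w


omit [Fintype β] [Fintype δ] in
omit [DecidableEq 𝓙] in
/-- `A_{J₀} = 1` where `Θ_{J₀} ≠ 0`. [folklore] -/
theorem chartCoord_self {J₀ : Option β × ThetaIdx γ δ} {w : β ⊕ (γ ⊕ δ) → ℂ}
    (h : theta L cls κM J₀ w ≠ 0) : chartCoord L cls κM J₀ J₀ w = 1 :=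
  div_self h


omit [Fintype β] [Fintype δ] in
omit [DecidableEq 𝓙] in
/-- **Dehomogenisation.** For a form `P` of degree `D` and a chart index `J₀` with
`Θ_{J₀}(w) ≠ 0`: `F_P(w) = Θ_{J₀}(w)^D · P(A(w))`, `A_J = Θ_J/Θ_{J₀}`. [folklore] -/
theorem thetaEval_eq_pow_mul_eval_chart {P : MvPolynomial (Option β × ThetaIdx γ δ) ℂ} {D : ℕ}
    (hP : P.IsHomogeneous D) (J₀ : Option β × ThetaIdx γ δ) {w : β ⊕ (γ ⊕ δ) → ℂ}
    (h : theta L cls κM J₀ w ≠ 0) :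
    thetaEval L cls κM P w = theta L cls κM J₀ w ^ D * MvPolynomial.eval (fun J => chartCoord L cls κM J₀ J w) P := by
  have e : (fun J => theta L cls κM J w) = theta L cls κM J₀ w • fun J => chartCoord L cls κM J₀ J w := by
    funext J
    simp [chartCoord, mul_div_cancel₀ _ h]
  rw [thetaEval, e, Projectivization.eval_smul_of_isHomogeneous hP]


omit [DecidableEq 𝓙] in
/-- The theta functions are analytic along every complex line in `Lie M_κ,ℂ`. [folklore] -/
theorem analyticAt_theta_line (J : Option β × ThetaIdx γ δ) (w x : β ⊕ (γ ⊕ δ) → ℂ) (ξ₀ : ℂ) :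
    AnalyticAt ℂ (fun ξ : ℂ => theta L cls κM J (w + ξ • x)) ξ₀ := by
  have hd : Differentiable ℂ (fun ξ : ℂ => theta L cls κM J (w + ξ • x)) :=
    (differentiable_theta L cls κM J).comp ((differentiable_const w).add (differentiable_id.smul_const x))
  exact hd.analyticAt ξ₀


omit [DecidableEq 𝓙] in
/-- `F_P` is analytic along every complex line. [folklore] -/
theorem analyticAt_thetaEval_line (P : MvPolynomial (Option β × ThetaIdx γ δ) ℂ)
    (w x : β ⊕ (γ ⊕ δ) → ℂ) (ξ₀ : ℂ) :
    AnalyticAt ℂ (fun ξ : ℂ => thetaEval L cls κM P (w + ξ • x)) ξ₀ := by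
  unfold thetaEval
  induction P using MvPolynomial.induction_on with
  | C a => simpa using analyticAt_const
  | add p q hp hq =>
    simp only [map_add]
    exact hp.add hq
  | mul_X p J hp =>
    simp only [map_mul, MvPolynomial.eval_X]
    exact hp.mul (analyticAt_theta_line L cls κM J w x ξ₀)


omit [DecidableEq 𝓙] in
/-- The chart expression `ξ ↦ P(A(w + ξx))` is analytic near `ξ = 0` when `Θ_{J₀}(w) ≠ 0`.
[folklore] -/
theorem analyticAt_eval_chart_line (P : MvPolynomial (Option β × ThetaIdx γ δ) ℂ)
    (J₀ : Option β × ThetaIdx γ δ) (w x : β ⊕ (γ ⊕ δ) → ℂ) {ξ₀ : ℂ}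
    (h : theta L cls κM J₀ (w + ξ₀ • x) ≠ 0) :
    AnalyticAt ℂ (fun ξ : ℂ => MvPolynomial.eval (fun J => chartCoord L cls κM J₀ J (w + ξ • x)) P) ξ₀ := by
  induction P using MvPolynomial.induction_on with
  | C a => simpa using analyticAt_const
  | add p q hp hq =>
    simp only [map_add]
    exact hp.add hq
  | mul_X p J hp =>
    have hJ : AnalyticAt ℂ (fun ξ : ℂ => chartCoord L cls κM J₀ J (w + ξ • x)) ξ₀ :=
      (analyticAt_theta_line L cls κM J w x ξ₀).div (analyticAt_theta_line L cls κM J₀ w x ξ₀) h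
    simp only [map_mul, MvPolynomial.eval_X]
    exact hp.mul hJ


omit [DecidableEq 𝓙] in
/-- **Vanishing along `𝔟` in a chart.** For a form `P` of degree `D` and a chart index `J₀` with
`Θ_{J₀}(w) ≠ 0`: `F_P` vanishes to order `≥ N` at `w` along `𝔟` iff, for every `x ∈ 𝔟`, the chart
expression `ξ ↦ P(A(w + ξx))` vanishes to order `≥ N` at `ξ = 0` (order transfer through the
non-vanishing factor `Θ_{J₀}(w + ξx)^D`). [cite: BakerWustholz2007, §6.8 (p. 119, Ψ(s) = ϱ^δ ξ)] -/
theorem vanishesAlong_thetaEval_iff_chart {P : MvPolynomial (Option β × ThetaIdx γ δ) ℂ} {D : ℕ}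
    (hP : P.IsHomogeneous D) (J₀ : Option β × ThetaIdx γ δ) (𝔟 : Submodule ℂ (β ⊕ (γ ⊕ δ) → ℂ))
    {w : β ⊕ (γ ⊕ δ) → ℂ} (h : theta L cls κM J₀ w ≠ 0) (N : ℕ) :
    VanishesAlong 𝔟 (thetaEval L cls κM P) w N ↔
      ∀ x ∈ 𝔟, ∀ k < N,
        iteratedDeriv k (fun ξ : ℂ => MvPolynomial.eval (fun J => chartCoord L cls κM J₀ J (w + ξ • x)) P) 0 = 0 := by
  refine forall₂_congr fun x _ => ?_
  have h0 : theta L cls κM J₀ (w + (0 : ℂ) • x) ≠ 0 := by simpa using h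
  -- near `ξ = 0`, `Θ_{J₀}(w + ξx) ≠ 0` and the dehomogenisation holds
  have hnear : ∀ᶠ ξ in 𝓝 (0 : ℂ), theta L cls κM J₀ (w + ξ • x) ≠ 0 :=
    (analyticAt_theta_line L cls κM J₀ w x 0).continuousAt.eventually_ne h0
  have heq : (fun ξ : ℂ => thetaEval L cls κM P (w + ξ • x)) =ᶠ[𝓝 0]
      fun ξ : ℂ => theta L cls κM J₀ (w + ξ • x) ^ D *
        MvPolynomial.eval (fun J => chartCoord L cls κM J₀ J (w + ξ • x)) P := by
    filter_upwards [hnear] with ξ hξ using thetaEval_eq_pow_mul_eval_chart L cls κM hP J₀ hξ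
  have hiter : ∀ k, iteratedDeriv k (fun ξ : ℂ => thetaEval L cls κM P (w + ξ • x)) 0 =
      iteratedDeriv k (fun ξ : ℂ => theta L cls κM J₀ (w + ξ • x) ^ D *
        MvPolynomial.eval (fun J => chartCoord L cls κM J₀ J (w + ξ • x)) P) 0 :=
    fun k => heq.iteratedDeriv_eq k
  simp only [hiter]
  have hpow : AnalyticAt ℂ (fun ξ : ℂ => theta L cls κM J₀ (w + ξ • x) ^ D) 0 :=
    (analyticAt_theta_line L cls κM J₀ w x 0).pow D
  exact forall_iteratedDeriv_mul_eq_zero_iff (analyticAt_eval_chart_line L cls κM P J₀ w x h0)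
    hpow (pow_ne_zero _ h0) N


/-! ### The chart coordinates as polynomials in the generators -/

/-- **The chart coordinates as polynomials in the generators.** [folklore] -/
def HPoly (c : γ → Bool) : Option β × ThetaIdx γ δ → MvPolynomial (Gen β γ δ) ℂ
  | (a, (M, none)) => TPoly a * ∏ b, rPoly (c b) b (M b)
  | (a, (M, some e)) => TPoly a *
      (X (Sum.inr (Sum.inr e)) * ∏ b, rPoly (c b) b (M b) -
        ∑ b, C (κM e b : ℂ) * (corrPoly (L (cls b)) (c b) b (M b) * ∏ b' ∈ Finset.univ.erase b, rPoly (c b') b' (M b')))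


omit [Fintype β] [Fintype δ] [DecidableEq γ] in
omit [DecidableEq 𝓙] in
/-- `rPoly` evaluates to `rVal` at the generators along the line. [folklore] -/
theorem eval_rPoly (c : γ → Bool) (w x : β ⊕ (γ ⊕ δ) → ℂ) (ξ : ℂ) (b : γ) (i : Fin 3) :
    MvPolynomial.eval (genFun L cls κM c w x ξ) (rPoly (c b) b i) =
      rVal (L (cls b)) (c b) i (w (iz b) + ξ * x (iz b)) := by
  cases hc : c b <;> fin_cases i <;> simp [rPoly, rVal, genFun, hc]


omit [Fintype β] [Fintype δ] [DecidableEq γ] in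
omit [DecidableEq 𝓙] in
/-- `corrPoly` evaluates to `corrVal` at the generators along the line. [folklore] -/
theorem eval_corrPoly (c : γ → Bool) (w x : β ⊕ (γ ⊕ δ) → ℂ) (ξ : ℂ) (b : γ) (i : Fin 3) :
    MvPolynomial.eval (genFun L cls κM c w x ξ) (corrPoly (L (cls b)) (c b) b i) =
      corrVal (L (cls b)) (c b) i (w (iz b) + ξ * x (iz b)) := by
  cases hc : c b <;> fin_cases i <;> simp [corrPoly, corrVal, genFun, hc]


omit [Fintype β] [Fintype δ] in
omit [DecidableEq 𝓙] in
/-- The base theta function along the line is the product of the factor bases: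
`Θ_{J₀(c)}(w') = ∏_b P_{i₀(b)}(z'_b)`. [folklore] -/
theorem theta_baseIdx (c : γ → Bool) (w' : β ⊕ (γ ⊕ δ) → ℂ) :
    theta L cls κM (baseIdx c) w' = ∏ b, (L (cls b)).univExtP (baseFin (c b)) (w' (iz b)) := by
  simp only [baseIdx, theta, thetaT_none, thetaP_none, one_mul]
  rfl


omit [Fintype β] [Fintype δ] in
omit [DecidableEq 𝓙] in
/-- **The chart coordinates are the polynomials `HPoly` in the generators**: for `ξ` in the
chart domain and every index `J`, `A_J(w + ξx) = HPoly_J(genFun(ξ))`. [folklore] -/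
theorem chartCoord_baseIdx_eq_eval (c : γ → Bool) (w x : β ⊕ (γ ⊕ δ) → ℂ) {ξ : ℂ}
    (hξ : ξ ∈ chartDomain L cls c w x) (J : Option β × ThetaIdx γ δ) :
    chartCoord L cls κM (baseIdx c) J (w + ξ • x) =
      MvPolynomial.eval (genFun L cls κM c w x ξ) (HPoly L cls κM c J) := by
  set w' : β ⊕ (γ ⊕ δ) → ℂ := w + ξ • x with hw'
  have hco : ∀ k, w' k = w k + ξ * x k := fun k => line_apply w x ξ k
  -- the factor data at the points `z'_b`
  set d : γ → ℂ := fun b => (L (cls b)).univExtP (baseFin (c b)) (w' (iz b)) with hd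
  set r : γ → ℂ := fun b => rVal (L (cls b)) (c b) ((J.2).1 b) (w' (iz b)) with hr
  set q : γ → ℂ := fun b => corrVal (L (cls b)) (c b) ((J.2).1 b) (w' (iz b)) with hq
  set t' : γ → ℂ := fun b => zetaHat (L (cls b)) (c b) (w' (iz b)) with ht'
  have hblk : ∀ b, d b ≠ 0 ∧ (L (cls b)).univExtP ((J.2).1 b) (w' (iz b)) = r b * d b ∧
      (L (cls b)).univExtZ ((J.2).1 b) (w' (iz b)) = (t' b * r b + q b) * d b := fun b => by
    have hv : FactorChartValid (L (cls b)) (c b) (w' (iz b)) := by rw [hco]; exact hξ b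
    exact factor_blocks (c b) hv _
  have hD : (∏ b, d b) ≠ 0 := Finset.prod_ne_zero_iff.mpr fun b _ => (hblk b).1
  have hbase : theta L cls κM (baseIdx c) w' = ∏ b, d b := theta_baseIdx L cls κM c w'
  -- values of the building blocks at the generators
  have er : ∀ b, MvPolynomial.eval (genFun L cls κM c w x ξ) (rPoly (c b) b ((J.2).1 b)) = r b :=
    fun b => by rw [eval_rPoly]; simp only [hr, hco]
  have eq_ : ∀ b, MvPolynomial.eval (genFun L cls κM c w x ξ) (corrPoly (L (cls b)) (c b) b ((J.2).1 b)) = q b :=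
    fun b => by rw [eval_corrPoly]; simp only [hq, hco]
  have eT : ∀ a : Option β, MvPolynomial.eval (genFun L cls κM c w x ξ) (TPoly a) = thetaT (γ := γ) (δ := δ) a w' := by
    rintro (_ | j)
    · simp [TPoly]
    · simp [TPoly, genFun, hco]
  have hnone : ∀ M : γ → Fin 3, (∀ b, (L (cls b)).univExtP (M b) (w' (iz b)) = r b * d b) →
      thetaPnone (β := β) (δ := δ) L cls M w' = (∏ b, r b) * ∏ b, d b := fun M hP => by
    unfold thetaPnone
    rw [← Finset.prod_mul_distrib]
    exact Finset.prod_congr rfl fun b _ => hP b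
  rcases J with ⟨a, M, _ | e⟩
  · -- `J = (a, (M, none))`
    have hP : ∀ b, (L (cls b)).univExtP (M b) (w' (iz b)) = r b * d b := fun b => (hblk b).2.1
    rw [chartCoord, hbase, theta, thetaP_none, hnone M hP, HPoly, map_mul, map_prod, eT,
      Finset.prod_congr rfl fun b _ => er b]
    field_simp
  · -- `J = (a, (M, some e))`
    have hP : ∀ b, (L (cls b)).univExtP (M b) (w' (iz b)) = r b * d b := fun b => (hblk b).2.1
    have hZ : ∀ b, (L (cls b)).univExtZ (M b) (w' (iz b)) = (t' b * r b - (-q b)) * d b := fun b => by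
      rw [(hblk b).2.2]; ring
    have hsome := thetaPsome_eq_mul_prod L cls κM M e w' d r (fun b => -q b) t' hP hZ
    rw [chartCoord, hbase, theta, thetaP_some, hsome, HPoly, map_mul, eT]
    simp only [map_sub, map_mul, map_sum, map_prod, eval_X, eval_C, er, eq_]
    have hS : genFun L cls κM c w x ξ (Sum.inr (Sum.inr e)) = w' (is e) - ∑ b, (κM e b : ℂ) * t' b := by
      simp [genFun, ht', hco]
    rw [hS]
    field_simp
    simp only [Finset.sum_neg_distrib]
    ring


omit [DecidableEq 𝓙] in
/-- **Jets of forms along lines are values of polynomials.** For a form `P` of degree `D`, a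
point `w`, a chart choice `c` valid at `w` along every direction (e.g. `chartChoiceAt L cls w`) and
`N`: `F_P` vanishes to order `≥ N` at `w` along `𝔟` iff for every `x ∈ 𝔟` and `k < N` the
polynomial `D_x^k(P ∘ HPoly)` vanishes at the generators `genFun_{w,x}(0)` — where
`D_x = PolyODE.der (genODE c x)`. [cite: BakerWustholz2007, §6.8 (p. 119)] -/
theorem vanishesAlong_thetaEval_iff_der {P : MvPolynomial (Option β × ThetaIdx γ δ) ℂ} {D : ℕ}
    (hP : P.IsHomogeneous D) (c : γ → Bool) (𝔟 : Submodule ℂ (β ⊕ (γ ⊕ δ) → ℂ))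
    {w : β ⊕ (γ ⊕ δ) → ℂ} (hc : ∀ x : β ⊕ (γ ⊕ δ) → ℂ, (0 : ℂ) ∈ chartDomain L cls c w x) (N : ℕ) :
    VanishesAlong 𝔟 (thetaEval L cls κM P) w N ↔
      ∀ x ∈ 𝔟, ∀ k < N,
        MvPolynomial.eval (genFun L cls κM c w x 0)
          ((PolyODE.der (genODE L cls κM c x))^[k] (MvPolynomial.bind₁ (HPoly L cls κM c) P)) = 0 := by
  -- `Θ_{J₀}(w) ≠ 0`
  have h0 : theta L cls κM (baseIdx c) w ≠ 0 := by
    rw [theta_baseIdx]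
    refine Finset.prod_ne_zero_iff.mpr fun b _ => ?_
    have hv := hc 0 b
    simp only [zero_mul, add_zero] at hv
    exact (factor_blocks (c b) hv 0).1
  rw [vanishesAlong_thetaEval_iff_chart L cls κM hP (baseIdx c) 𝔟 h0 N]
  refine forall₂_congr fun x _ => forall₂_congr fun k _ => ?_
  -- near `ξ = 0` the chart expression is `(P ∘ HPoly)(genFun ξ)`
  have hopen := isOpen_chartDomain L cls c w x
  have hev : ∀ᶠ ξ in 𝓝 (0 : ℂ), ξ ∈ chartDomain L cls c w x := hopen.mem_nhds (hc x)
  have heq : (fun ξ : ℂ => MvPolynomial.eval (fun J => chartCoord L cls κM (baseIdx c) J (w + ξ • x)) P)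
      =ᶠ[𝓝 0] fun ξ => MvPolynomial.eval (genFun L cls κM c w x ξ) (MvPolynomial.bind₁ (HPoly L cls κM c) P) := by
    filter_upwards [hev] with ξ hξ
    have hb : MvPolynomial.eval (genFun L cls κM c w x ξ) (MvPolynomial.bind₁ (HPoly L cls κM c) P) =
        MvPolynomial.eval (fun J => MvPolynomial.eval (genFun L cls κM c w x ξ) (HPoly L cls κM c J)) P :=
      MvPolynomial.eval₂Hom_bind₁ _ _ _ _
    have hfun : (fun J => chartCoord L cls κM (baseIdx c) J (w + ξ • x)) =
        fun J => MvPolynomial.eval (genFun L cls κM c w x ξ) (HPoly L cls κM c J) :=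
      funext fun J => chartCoord_baseIdx_eq_eval L cls κM c w x hξ J
    rw [hb, hfun]
  rw [heq.iteratedDeriv_eq k, iteratedDeriv_eval_genFun L cls κM c w x _ k (hc x)]


/-! ### Word forms -/

omit [Fintype β] [Fintype δ] [DecidableEq γ] in
omit [DecidableEq 𝓙] in
/-- The line derivation data is additive in the direction. [folklore] -/
theorem genODE_add (c : γ → Bool) (x x' : β ⊕ (γ ⊕ δ) → ℂ) (i : Gen β γ δ) :
    genODE L cls κM c (x + x') i = genODE L cls κM c x i + genODE L cls κM c x' i := by
  rcases i with j | ⟨b, i⟩ | e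
  · simp only [genODE, Pi.add_apply, map_add]; ring
  · simp only [genODE, Pi.add_apply, map_add]; ring
  · simp only [genODE, Pi.add_apply, map_add, mul_add, add_mul, Finset.sum_add_distrib]; ring


omit [Fintype β] [Fintype δ] [DecidableEq γ] in
omit [DecidableEq 𝓙] in
/-- The line derivation data is homogeneous in the direction. [folklore] -/
theorem genODE_smul (c : γ → Bool) (a : ℂ) (x : β ⊕ (γ ⊕ δ) → ℂ) (i : Gen β γ δ) :
    genODE L cls κM c (a • x) i = a • genODE L cls κM c x i := by
  rcases i with j | ⟨b, i⟩ | e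
  · simp only [genODE, Pi.smul_apply, smul_eq_mul, map_mul, smul_eq_C_mul]; ring
  · simp only [genODE, Pi.smul_apply, smul_eq_mul, map_mul, smul_eq_C_mul]; ring
  · simp only [genODE, Pi.smul_apply, smul_eq_mul, map_mul, smul_eq_C_mul, Finset.mul_sum, mul_sub]
    congr 1
    exact Finset.sum_congr rfl fun b _ => by ring


/-- `x ↦ genODE c x i` as a linear map. [folklore] -/
def genODEₗ (c : γ → Bool) (i : Gen β γ δ) : (β ⊕ (γ ⊕ δ) → ℂ) →ₗ[ℂ] MvPolynomial (Gen β γ δ) ℂ where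
  toFun x := genODE L cls κM c x i
  map_add' x x' := genODE_add L cls κM c x x' i
  map_smul' a x := genODE_smul L cls κM c a x i


omit [Fintype β] [Fintype δ] [DecidableEq γ] in
omit [DecidableEq 𝓙] in
/-- The line derivation data is linear in the direction. [folklore] -/
theorem genODE_sum_smul {d : ℕ} (c : γ → Bool) (cs : Fin d → ℂ) (xs : Fin d → β ⊕ (γ ⊕ δ) → ℂ)
    (i : Gen β γ δ) :
    genODE L cls κM c (∑ m, cs m • xs m) i = ∑ m, cs m • genODE L cls κM c (xs m) i := by
  have := map_sum (genODEₗ L cls κM c i) (fun m => cs m • xs m) Finset.univ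
  simpa only [map_smul, genODEₗ, LinearMap.coe_mk, AddHom.coe_mk] using this


omit [Fintype β] [Fintype δ] [DecidableEq γ] in
omit [DecidableEq 𝓙] in
/-- Hence the derivation `D_x` is linear in `x`: `D_{∑ c_m x_m} = ∑ c_m D_{x_m}`. [folklore] -/
theorem der_genODE_sum_smul {d : ℕ} (c : γ → Bool) (cs : Fin d → ℂ)
    (xs : Fin d → β ⊕ (γ ⊕ δ) → ℂ) :
    PolyODE.der (genODE L cls κM c (∑ m, cs m • xs m)) =
      ∑ m, cs m • PolyODE.der (genODE L cls κM c (xs m)) := by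
  refine MvPolynomial.derivation_ext fun i => ?_
  rw [PolyODE.der_X, genODE_sum_smul, Derivation.coe_sum_smul, Finset.sum_apply]
  exact Finset.sum_congr rfl fun m _ => by rw [Pi.smul_apply, PolyODE.der_X]


/-- **The word forms** `Λ_ω(P) = (D_{ω₀} ∘ ⋯ ∘ D_{ω_{k-1}} (P ∘ HPoly))(gens(w))` of a polynomial
`P` at the point `w`, for a chart choice `c` and directions `x_1, …, x_d`; `ℂ`-linear in `P`.
[cite: BakerWustholz2007, §6.8 (p. 118)] -/
def wordForm {d : ℕ} (c : γ → Bool) (xs : Fin d → β ⊕ (γ ⊕ δ) → ℂ) (w : β ⊕ (γ ⊕ δ) → ℂ)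
    {k : ℕ} (ω : Fin k → Fin d) (P : MvPolynomial (Option β × ThetaIdx γ δ) ℂ) : ℂ :=
  MvPolynomial.eval (genFun L cls κM c w 0 0)
    (PolyODE.wordApp (fun m => (PolyODE.der (genODE L cls κM c (xs m))).toLinearMap) ω
      (MvPolynomial.bind₁ (HPoly L cls κM c) P))


omit [Fintype β] [Fintype δ] in
omit [DecidableEq 𝓙] in
/-- The word forms are additive in `P`. [folklore] -/
theorem wordForm_add {d : ℕ} (c : γ → Bool) (xs : Fin d → β ⊕ (γ ⊕ δ) → ℂ)
    (w : β ⊕ (γ ⊕ δ) → ℂ) {k : ℕ} (ω : Fin k → Fin d) (P Q : MvPolynomial (Option β × ThetaIdx γ δ) ℂ) :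
    wordForm L cls κM c xs w ω (P + Q) = wordForm L cls κM c xs w ω P + wordForm L cls κM c xs w ω Q := by
  simp [wordForm, map_add]


omit [Fintype β] [Fintype δ] in
omit [DecidableEq 𝓙] in
/-- The word forms are homogeneous in `P`. [folklore] -/
theorem wordForm_smul {d : ℕ} (c : γ → Bool) (xs : Fin d → β ⊕ (γ ⊕ δ) → ℂ)
    (w : β ⊕ (γ ⊕ δ) → ℂ) {k : ℕ} (ω : Fin k → Fin d) (a : ℂ) (P : MvPolynomial (Option β × ThetaIdx γ δ) ℂ) :
    wordForm L cls κM c xs w ω (a • P) = a * wordForm L cls κM c xs w ω P := by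
  simp only [wordForm, map_smul, MvPolynomial.smul_eval]


omit [DecidableEq 𝓙] in
/-- **Finitely many linear conditions force vanishing along the span.** Let `P` be a form of
degree `D`, `w` a point with a chart choice `c` valid at `w`, and `x_1, …, x_d` directions. If
for every `k < T` and every content `α` the sum of the word forms `Λ_ω(P)` over the words
`ω : Fin k → Fin d` of content `α` vanishes, then `F_P` vanishes to order `≥ T` at `w` along
`𝔟 = span{x_m}`. [cite: BakerWustholz2007, §6.8 (p. 118)] -/
theorem vanishesAlong_span_of_wordForms {P : MvPolynomial (Option β × ThetaIdx γ δ) ℂ} {D : ℕ}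
    (hP : P.IsHomogeneous D) (c : γ → Bool) {w : β ⊕ (γ ⊕ δ) → ℂ}
    (hc : ∀ x : β ⊕ (γ ⊕ δ) → ℂ, (0 : ℂ) ∈ chartDomain L cls c w x) {d : ℕ}
    (xs : Fin d → β ⊕ (γ ⊕ δ) → ℂ) (T : ℕ)
    (h : ∀ k < T, ∀ α : Fin d → Fin (k + 1),
      ∑ ω ∈ Finset.univ.filter (fun ω : Fin k → Fin d => ∀ m, PolyODE.content ω m = α m),
        wordForm L cls κM c xs w ω P = 0) :
    VanishesAlong (Submodule.span ℂ (Set.range xs)) (thetaEval L cls κM P) w T := by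
  rw [vanishesAlong_thetaEval_iff_der L cls κM hP c _ hc T]
  intro x hx k hk
  obtain ⟨cs, rfl⟩ := Submodule.mem_span_range_iff_exists_fun ℂ |>.mp hx
  -- `gens(w)` does not depend on the direction
  have hg : genFun L cls κM c w (∑ m, cs m • xs m) 0 = genFun L cls κM c w 0 0 := by
    funext i; rcases i with j | ⟨b, i⟩ | e <;> simp [genFun]
  rw [hg, der_genODE_sum_smul]
  -- the derivation sum, as a function, is the sum of the linear maps
  set Dm : Fin d → MvPolynomial (Gen β γ δ) ℂ →ₗ[ℂ] MvPolynomial (Gen β γ δ) ℂ :=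
    fun m => (PolyODE.der (genODE L cls κM c (xs m))).toLinearMap with hDm
  have hfun : (⇑(∑ m, cs m • PolyODE.der (genODE L cls κM c (xs m))) :
      MvPolynomial (Gen β γ δ) ℂ → MvPolynomial (Gen β γ δ) ℂ) = ⇑(∑ m, cs m • Dm m) := by
    rw [Derivation.coe_sum_smul, LinearMap.coe_sum]
    exact Finset.sum_congr rfl fun m _ => by rw [LinearMap.coe_smul, hDm, Derivation.coeFn_coe]
  rw [hfun]
  have key := PolyODE.apply_iterate_sum_smul_eq_zero Dm k (MvPolynomial.bind₁ (HPoly L cls κM c) P)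
    (MvPolynomial.aeval (genFun L cls κM c w 0 0)).toLinearMap (fun α => ?_) cs
  · simpa [MvPolynomial.coe_aeval_eq_eval] using key
  · have := h k hk α
    simp only [wordForm] at this
    convert this using 2 with ω
    · ext ω'
      simp
    · simp [hDm]


/-! ### The generators are chart coordinates; algebraic values -/

omit [Fintype β] [Fintype δ] in
omit [DecidableEq 𝓙] in
/-- At `w ∈ Alg` every affine chart coordinate `Θ_J(w)/Θ_{J₀}(w)` is an algebraic number (also,
trivially, in the degenerate case `Θ_{J₀}(w) = 0` where it is the junk value `0`).
[cite: BakerWustholz2007, §6.8 (p. 119)] -/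
theorem chartCoord_mem_Kbar (hL : ∀ i, IsAlgebraic ℚ (L i).g₂ ∧ IsAlgebraic ℚ (L i).g₃)
    {w : β ⊕ (γ ⊕ δ) → ℂ} (hw : w ∈ Alg L cls κM) (J₀ J : Option β × ThetaIdx γ δ) :
    chartCoord L cls κM J₀ J w ∈ algebraicClosure ℚ ℂ := by
  obtain ⟨J₁, hJ₁, halg⟩ := exists_theta_div_mem_Kbar (β := β) hL κM hw
  have e : chartCoord L cls κM J₀ J w =
      (theta L cls κM J w / theta L cls κM J₁ w) / (theta L cls κM J₀ w / theta L cls κM J₁ w) := by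
    rw [chartCoord, div_div_div_cancel_right₀ hJ₁]
  rw [e]
  exact div_mem (halg J) (halg J₀)


omit [Fintype β] [Fintype δ] in
omit [DecidableEq 𝓙] in
/-- **The generators are chart coordinates**: for a chart choice valid at `w` (along `x`, at
`ξ = 0`), `genFun(0) i = A_{J(i)}(w)`. [folklore] -/
theorem genFun_zero_eq_chartCoord (c : γ → Bool) (w x : β ⊕ (γ ⊕ δ) → ℂ)
    (hc : (0 : ℂ) ∈ chartDomain L cls c w x) (i : Gen β γ δ) :
    genFun L cls κM c w x 0 i = chartCoord L cls κM (baseIdx c) (genIdx c i) w := by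
  have key := chartCoord_baseIdx_eq_eval L cls κM c w x hc (genIdx c i)
  simp only [zero_smul, add_zero] at key
  rw [key]
  -- evaluate `HPoly (genIdx c i)` at the generators
  have er : ∀ (b : γ) (k : Fin 3), MvPolynomial.eval (genFun L cls κM c w x 0) (rPoly (c b) b k) =
      rVal (L (cls b)) (c b) k (w (iz b)) := fun b k => by
    rw [eval_rPoly]; simp
  rcases i with j | ⟨b, i⟩ | e
  · -- torus
    simp [genIdx, HPoly, TPoly, genFun, er, -Fintype.sum_sum_type, -Fintype.prod_sum_type]
  · -- factor generator
    simp only [genIdx, HPoly, TPoly, one_mul, map_prod, er]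
    rw [Finset.prod_eq_single b]
    · simp [genFun]
    · intro b' _ hb'
      rw [Function.update_of_ne hb', rVal_baseFin]
    · intro h; exact absurd (Finset.mem_univ b) h
  · -- fibre generator
    have ec : ∀ b, MvPolynomial.eval (genFun L cls κM c w x 0) (corrPoly (L (cls b)) (c b) b (baseFin (c b))) = 0 :=
      fun b => by rw [eval_corrPoly]; simp
    simp [genIdx, HPoly, TPoly, er, ec, -Fintype.sum_sum_type, -Fintype.prod_sum_type]


omit [Fintype β] [Fintype δ] in
omit [DecidableEq 𝓙] in
/-- The base theta function does not vanish at a point with a valid chart choice. [folklore] -/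
theorem theta_baseIdx_ne_zero (c : γ → Bool) {w x : β ⊕ (γ ⊕ δ) → ℂ}
    (hc : (0 : ℂ) ∈ chartDomain L cls c w x) : theta L cls κM (baseIdx c) w ≠ 0 := by
  rw [theta_baseIdx]
  refine Finset.prod_ne_zero_iff.mpr fun b _ => ?_
  have hv := hc b
  simp only [zero_mul, add_zero] at hv
  exact (factor_blocks (c b) hv 0).1


omit [Fintype β] [Fintype δ] in
omit [DecidableEq 𝓙] in
/-- **All generator values at an algebraic point are algebraic numbers.** For `w ∈ Alg L κ`,
`g₂, g₃ ∈ ℚ̄` and a chart choice valid at `w`: `genFun(0) i ∈ ℚ̄` for every `i`.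
[cite: BakerWustholz2007, §6.8 (p. 119: `f_i(sv) = ϱX_i(sγ)` with `X_i(sγ)` algebraic)] -/
theorem genFun_zero_mem_Kbar (hL : ∀ i, IsAlgebraic ℚ (L i).g₂ ∧ IsAlgebraic ℚ (L i).g₃) (c : γ → Bool)
    {w : β ⊕ (γ ⊕ δ) → ℂ} (hw : w ∈ Alg L cls κM) (x : β ⊕ (γ ⊕ δ) → ℂ)
    (hc : (0 : ℂ) ∈ chartDomain L cls c w x) (i : Gen β γ δ) :
    genFun L cls κM c w x 0 i ∈ algebraicClosure ℚ ℂ := by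
  rw [genFun_zero_eq_chartCoord L cls κM c w x hc i]
  exact chartCoord_mem_Kbar L cls κM hL hw _ _


omit [Fintype β] [Fintype δ] in
omit [DecidableEq 𝓙] in
/-- The same, as `IsAlgebraic`. [folklore] -/
theorem isAlgebraic_genFun_zero (hL : ∀ i, IsAlgebraic ℚ (L i).g₂ ∧ IsAlgebraic ℚ (L i).g₃) (c : γ → Bool)
    {w : β ⊕ (γ ⊕ δ) → ℂ} (hw : w ∈ Alg L cls κM) (x : β ⊕ (γ ⊕ δ) → ℂ)
    (hc : (0 : ℂ) ∈ chartDomain L cls c w x) (i : Gen β γ δ) :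
    IsAlgebraic ℚ (genFun L cls κM c w x 0 i) :=
  mem_algebraicClosure_iff.mp (genFun_zero_mem_Kbar L cls κM hL c hw x hc i)


/-! ### Non-vanishing of forms built from affine polynomials -/

omit [Fintype β] [Fintype δ] in
omit [DecidableEq 𝓙] in
/-- **The auxiliary function in the generic chart**: where `Θ_{J₀}(w) ≠ 0`,
`F_{homog D Q}(w) = Θ_{J₀}(w)^D · Q(A(w) ∘ affIdx)`. [folklore] -/
theorem thetaEval_homog {D : ℕ} {Q : MvPolynomial (β ⊕ (γ ⊕ δ)) ℂ} (hQ : Q.totalDegree ≤ D)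
    {w : β ⊕ (γ ⊕ δ) → ℂ} (h0 : theta L cls κM (baseIdx (genericChart (γ := γ))) w ≠ 0) :
    thetaEval L cls κM (homog D Q) w = theta L cls κM (baseIdx (genericChart (γ := γ))) w ^ D *
      MvPolynomial.eval (fun a => chartCoord L cls κM (baseIdx (genericChart (γ := γ))) (affIdx a) w) Q := by
  rw [thetaEval_eq_pow_mul_eval_chart L cls κM (isHomogeneous_homog D Q) _ h0,
    eval_homog_of_base_eq_one hQ (chartCoord_self L cls κM h0)]
  rfl


omit [Fintype β] [Fintype δ] in
omit [DecidableEq 𝓙] in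
/-- The affine coordinates at a point all of whose `E`-coordinates are off the lattice:
`(e^{y_j}, ℘(z_b), s_e - ∑_b κ_{eb} ζ(z_b))`. [folklore] -/
theorem chartCoord_affIdx {w : β ⊕ (γ ⊕ δ) → ℂ} (hw : ∀ b, w (iz b) ∉ (L (cls b)).lattice) (a : β ⊕ (γ ⊕ δ)) :
    chartCoord L cls κM (baseIdx (genericChart (γ := γ))) (affIdx a) w =
      Sum.elim (fun j => cexp (w (iy j)))
        (Sum.elim (fun b => ℘[L (cls b)] (w (iz b)))
          (fun e => w (is e) - ∑ b, (κM e b : ℂ) * (L (cls b)).weierstrassZeta (w (iz b)))) a := by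
  have hc : (0 : ℂ) ∈ chartDomain L cls (genericChart (γ := γ)) w w := fun b => by
    simpa [FactorChartValid, genericChart] using hw b
  rw [affIdx, ← genFun_zero_eq_chartCoord L cls κM _ w w hc (affGen a)]
  rcases a with j | b | e <;> simp [affGen, genFun, genericChart]


omit [Fintype β] [Fintype δ] in
omit [DecidableEq 𝓙] in
/-- **Every point of the box `(ℂ^×)^β × ℂ^γ × ℂ^δ` is a value of the affine coordinates** at a
point with all `E`-coordinates off the lattice (`exp` onto `ℂ^×`, `℘` onto `ℂ`, translation in
`s`). [folklore] -/
theorem exists_chartCoord_affIdx_eq (x : β ⊕ (γ ⊕ δ) → ℂ) (hx : ∀ j, x (iy j) ≠ 0) :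
    ∃ w : β ⊕ (γ ⊕ δ) → ℂ, (∀ b, w (iz b) ∉ (L (cls b)).lattice) ∧
      ∀ a, chartCoord L cls κM (baseIdx (genericChart (γ := γ))) (affIdx a) w = x a := by
  choose z hz hz℘ using fun b => PeriodPair.exists_weierstrassP_eq (L := L (cls b)) (x (iz b))
  refine ⟨Sum.elim (fun j => Complex.log (x (iy j)))
    (Sum.elim z (fun e => x (is e) + ∑ b, (κM e b : ℂ) * (L (cls b)).weierstrassZeta (z b))), ?_, ?_⟩
  · intro b; simpa [iz] using hz b
  · have hw : ∀ b, (Sum.elim (fun j => Complex.log (x (iy j)))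
        (Sum.elim z (fun e => x (is e) + ∑ b, (κM e b : ℂ) * (L (cls b)).weierstrassZeta (z b))) :
          β ⊕ (γ ⊕ δ) → ℂ) (iz b) ∉ (L (cls b)).lattice := fun b => by simpa [iz] using hz b
    intro a
    rw [chartCoord_affIdx L cls κM hw]
    rcases a with j | b | e
    · simpa [iy] using Complex.exp_log (hx j)
    · simpa [iz] using hz℘ b
    · simp [is, iz]


omit [Fintype β] [Fintype δ] in
omit [DecidableEq 𝓙] in
/-- **A form built from a non-zero affine polynomial does not vanish identically on `M_κ`.**
For `Q ≠ 0` of total degree `≤ D`: `F_{homog D Q} ≢ 0`. [cite: BakerWustholz2007, §6.8 (p. 118)] -/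
theorem exists_thetaEval_homog_ne_zero {D : ℕ} {Q : MvPolynomial (β ⊕ (γ ⊕ δ)) ℂ}
    (hQ : Q ≠ 0) (hD : Q.totalDegree ≤ D) :
    ∃ w, thetaEval L cls κM (homog D Q) w ≠ 0 := by
  by_contra! H
  apply hQ
  -- `Q` vanishes on the box `(ℂ^×)^β × ℂ^γ × ℂ^δ`
  refine MvPolynomial.funext_set (fun a : β ⊕ (γ ⊕ δ) => Sum.elim (fun _ => {u : ℂ | u ≠ 0})
      (fun _ => Set.univ) a) (fun a => ?_) fun x hx => ?_
  · rcases a with j | be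
    · show Set.Infinite {u : ℂ | u ≠ 0}
      rw [show {u : ℂ | u ≠ 0} = ({0} : Set ℂ)ᶜ from Set.ext fun u => by simp]
      exact (Set.finite_singleton (0 : ℂ)).infinite_compl
    · exact Set.infinite_univ
  · have hx' : ∀ j, x (iy j) ≠ 0 := fun j => by
      have := hx (iy j) (Set.mem_univ _)
      simpa [iy] using this
    obtain ⟨w, hw, hA⟩ := exists_chartCoord_affIdx_eq L cls κM x hx'
    have h0 : theta L cls κM (baseIdx (genericChart (γ := γ))) w ≠ 0 := by
      have hc : (0 : ℂ) ∈ chartDomain L cls (genericChart (γ := γ)) w w := fun b => by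
        simpa [FactorChartValid, genericChart] using hw b
      exact theta_baseIdx_ne_zero L cls κM _ hc
    have key := H w
    rw [thetaEval_homog L cls κM hD h0, mul_eq_zero, pow_eq_zero_iff', funext hA] at key
    simpa [h0] using key



/-! ### Generic-coefficient models of `genODE` and `HPoly` (lattice family) -/

section Model

variable {R S : Type*} [Field R] [Field S]

open GaGmE.Std (factorODEᵣ zetaHatODEᵣ rPolyᵣ corrPolyᵣ TPolyᵣ map_factorODEᵣ map_zetaHatODEᵣ
  map_rPolyᵣ map_corrPolyᵣ map_TPolyᵣ)

/-- **Generic-coefficient model of the line derivation data `genODE`** (coefficients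
`g₂ i, g₃ i ∈ R` of the lattices of the classes, `κ : δ → γ → R`, direction coordinates `x`); the
block `b` with the coefficients of its class `cls b`. [folklore] -/
def genODEᵣ (g2 g3 : 𝓙 → R) (κ : δ → γ → R) (c : γ → Bool)
    (x : β ⊕ (γ ⊕ δ) → R) : Gen β γ δ → MvPolynomial (Gen β γ δ) R
  | Sum.inl j => C (x (iy j)) * X (Sum.inl j)
  | Sum.inr (Sum.inl (b, i)) => C (x (iz b)) * factorODEᵣ (g2 (cls b)) (g3 (cls b)) (c b) b i
  | Sum.inr (Sum.inr e) => C (x (is e)) -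
      ∑ b, C (κ e b * x (iz b)) * zetaHatODEᵣ (g2 (cls b)) (g3 (cls b)) (c b) b

/-- **Generic-coefficient model of the chart polynomials `HPoly`** (lattice family). [folklore] -/
def HPolyᵣ (g2 g3 : 𝓙 → R) (κ : δ → γ → R) (c : γ → Bool) :
    Option β × ThetaIdx γ δ → MvPolynomial (Gen β γ δ) R
  | (a, (M, none)) => TPolyᵣ a * ∏ b, rPolyᵣ (c b) b (M b)
  | (a, (M, some e)) => TPolyᵣ a *
      (X (Sum.inr (Sum.inr e)) * ∏ b, rPolyᵣ (c b) b (M b) -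
        ∑ b, C (κ e b) * (corrPolyᵣ (g2 (cls b)) (g3 (cls b)) (c b) b (M b) *
          ∏ b' ∈ Finset.univ.erase b, rPolyᵣ (c b') b' (M b')))

omit [Fintype β] [Fintype δ] [DecidableEq γ] in
omit [DecidableEq 𝓙] in
/-- `genODEᵣ` over `ℂ` with the coefficients of the `Λ_i` and `κ` is `genODE`. [folklore] -/
theorem genODEᵣ_complex (c : γ → Bool) (x : β ⊕ (γ ⊕ δ) → ℂ) :
    genODEᵣ cls (fun i => (L i).g₂) (fun i => (L i).g₃) (fun e b => (κM e b : ℂ)) c x =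
      genODE L cls κM c x := by
  funext i
  rcases i with j | ⟨b, i⟩ | e
  · rfl
  · rfl
  · rfl

omit [Fintype β] [Fintype δ] in
omit [DecidableEq 𝓙] in
/-- `HPolyᵣ` over `ℂ` with the coefficients of the `Λ_i` and `κ` is `HPoly`. [folklore] -/
theorem HPolyᵣ_complex (c : γ → Bool) :
    (HPolyᵣ cls (fun i => (L i).g₂) (fun i => (L i).g₃) (fun e b => (κM e b : ℂ)) c :
      Option β × ThetaIdx γ δ → MvPolynomial (Gen β γ δ) ℂ) = HPoly L cls κM c := by
  funext J
  rcases J with ⟨a, M, _ | e⟩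
  · rfl
  · rfl

omit [Fintype β] [Fintype δ] [DecidableEq γ] in
omit [DecidableEq 𝓙] in
/-- **`genODEᵣ` commutes with base change.** [folklore] -/
theorem map_genODEᵣ (f : R →+* S) (g2 g3 : 𝓙 → R) (κ : δ → γ → R) (c : γ → Bool)
    (x : β ⊕ (γ ⊕ δ) → R) (i : Gen β γ δ) :
    map f (genODEᵣ cls g2 g3 κ c x i) =
      genODEᵣ cls (fun j => f (g2 j)) (fun j => f (g3 j)) (fun e b => f (κ e b)) c
        (fun k => f (x k)) i := by
  rcases i with j | ⟨b, i⟩ | e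
  · simp [genODEᵣ]
  · simp [genODEᵣ, map_factorODEᵣ]
  · simp [genODEᵣ, map_zetaHatODEᵣ, map_sum]

omit [Fintype β] [Fintype δ] in
omit [DecidableEq 𝓙] in
/-- **`HPolyᵣ` commutes with base change.** [folklore] -/
theorem map_HPolyᵣ (f : R →+* S) (g2 g3 : 𝓙 → R) (κ : δ → γ → R) (c : γ → Bool)
    (J : Option β × ThetaIdx γ δ) :
    map f (HPolyᵣ cls g2 g3 κ c J) =
      HPolyᵣ cls (fun j => f (g2 j)) (fun j => f (g3 j)) (fun e b => f (κ e b)) c J := by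
  rcases J with ⟨a, M, _ | e⟩
  · simp [HPolyᵣ, map_TPolyᵣ, map_rPolyᵣ, map_prod]
  · simp [HPolyᵣ, map_TPolyᵣ, map_rPolyᵣ, map_corrPolyᵣ, map_prod, map_sum]

end Model

/-! ### The word forms computed over a subfield -/

omit [Fintype β] [Fintype δ] in
omit [DecidableEq 𝓙] in
/-- **Word forms over a field of definition** (lattice family): with `f : K →+* ℂ` sending
`g₂ᴷ i, g₃ᴷ i, κᴷ, xᴷ` to the invariants of the `Λ_i`, to `κ` and `x`, `gᴷ` to the generator
values at `w`, and `Pᴷ` to `P`, the word form `Λ_ω(P)` at `w` is the image under `f` of the same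
expression computed over `K`. [folklore] -/
theorem wordForm_eq_map {K : Type*} [Field K] (f : K →+* ℂ)
    {g2 g3 : 𝓙 → K} (hg2 : ∀ i, f (g2 i) = (L i).g₂) (hg3 : ∀ i, f (g3 i) = (L i).g₃)
    {κ : δ → γ → K}
    (hκ : ∀ e b, f (κ e b) = κM e b) (c : γ → Bool) {d : ℕ} {xs : Fin d → β ⊕ (γ ⊕ δ) → ℂ}
    {xK : Fin d → β ⊕ (γ ⊕ δ) → K} (hx : ∀ m k, f (xK m k) = xs m k)
    {w : β ⊕ (γ ⊕ δ) → ℂ}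
    {gK : Gen β γ δ → K} (hg : ∀ i, f (gK i) = genFun L cls κM c w 0 0 i)
    {P : MvPolynomial (Option β × ThetaIdx γ δ) ℂ}
    {PK : MvPolynomial (Option β × ThetaIdx γ δ) K}
    (hP : map f PK = P) {k : ℕ} (ω : Fin k → Fin d) :
    wordForm L cls κM c xs w ω P =
      f (MvPolynomial.eval gK
        (PolyODE.wordApp (fun m => (mkDerivation K (genODEᵣ cls g2 g3 κ c (xK m))).toLinearMap) ω
          (MvPolynomial.bind₁ (HPolyᵣ cls g2 g3 κ c) PK))) := by
  have eg2 : (fun j => f (g2 j)) = fun j => (L j).g₂ := funext hg2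
  have eg3 : (fun j => f (g3 j)) = fun j => (L j).g₃ := funext hg3
  have hQ : ∀ m i, map f (genODEᵣ cls g2 g3 κ c (xK m) i) = genODE L cls κM c (xs m) i := by
    intro m i
    rw [map_genODEᵣ, eg2, eg3]
    have e1 : (fun e b => f (κ e b)) = fun e b => (κM e b : ℂ) := funext fun e => funext fun b => hκ e b
    have e2 : (fun k => f (xK m k)) = xs m := funext fun k => hx m k
    rw [e1, e2, genODEᵣ_complex]
  have hH : (fun J : Option β × ThetaIdx γ δ => map f (HPolyᵣ cls g2 g3 κ c J)) =
      HPoly L cls κM c := by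
    funext J
    rw [map_HPolyᵣ, eg2, eg3]
    have e1 : (fun e b => f (κ e b)) = fun e b => (κM e b : ℂ) := funext fun e => funext fun b => hκ e b
    rw [e1, ← HPolyᵣ_complex (β := β) L cls κM c]
  have hgf : (fun i => f (gK i)) = genFun L cls κM c w 0 0 := funext hg
  set Y := PolyODE.wordApp (fun m => (mkDerivation K (genODEᵣ cls g2 g3 κ c (xK m))).toLinearMap) ω
    (MvPolynomial.bind₁ (HPolyᵣ cls g2 g3 κ c) PK) with hY
  have hev : f (MvPolynomial.eval gK Y) = MvPolynomial.eval (fun i => f (gK i)) (map f Y) := by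
    rw [eval_map, show MvPolynomial.eval gK Y = eval₂ (RingHom.id K) gK Y from rfl, eval₂_comp_left,
      RingHom.comp_id]
    rfl
  rw [hev, hY, PolyODE.map_wordApp, map_bind₁, hP, hgf]
  simp only [hQ]
  rw [show (fun J : Option β × ThetaIdx γ δ => map f (HPolyᵣ cls g2 g3 κ c J)) =
    HPoly L cls κM c from hH]
  rfl

end Std

end GaGmEFam

end Literature.NumberTheory.Transcendental

end
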